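import Mathlib
import Summits.Ventures.DiscreteObjects.Mahler.SmythTheorem
import Summits.Ventures.DiscreteObjects.Mahler.MahlerMeasureCompXPow
import Summits.Ventures.DiscreteObjects.Mahler.LehmerLowerBound
import Summits.Ventures.DiscreteObjects.Mahler.UnitMeasureFactors
import Summits.Ventures.DiscreteObjects.Mahler.LehmerExactMeasure

/-!
# Integer polynomials with at most three monomials: `M ∈ {0, 1} ∪ [θ₀, ∞)` (venture `DiscreteObjects`, target L)

Cell `pub-namedobj`, seat `pub-namedobj-mahler-g24`. Framing: lottery ticket; floor = certified
bounds/negative ranges.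

**Theorem** (`smythTheta_le_measure_of_card_support_le_three`).  If `P ∈ ℤ[X]` has at most three nonzero
coefficients and `M(P) > 1`, then `M(P) ≥ θ₀ = 1.3247…` (Smyth's constant, attained by `x³ - x - 1`).
Folklore given Smyth's theorem (e.g. Dobrowolski, Acta Arith. 123 (2006), p.205: "for `k = 3`, in the case of
a reciprocal polynomial `f`, we trivially get `M(f) ≥ (3 + √5)/2`, while for nonreciprocal polynomials
`M(f) ≥ θ` by Smyth's result"); kernel version, no hypothesis on `P`: strip `x^j`; constants; nonreciprocal
`P` by Smyth's theorem (`SmythTheorem`, kernel gen 8); leading coefficient `≥ 2`; and a monic (anti)reciprocal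
`P` with `≤ 3` monomials is `xⁿ + ε` (`M = 1`) or `R(x^m)` with `R = x² + cx + 1`, where `|c| ≤ 2` gives
`M = 1` and `|c| ≥ 3` a real root of modulus `≥ 3/2 > θ₀`.  REPLICATION (folklore).
For four monomials see `SparseSubLehmer` ([Dobrowolski2006, Prop. 2]).

* `card_support_X_pow_mul`, `intMahlerMeasure_X_pow`, `intMahlerMeasure_X_pow_add_sign` — bookkeeping;
* `measure_quadratic_eq_one_of_abs_le_two`, `three_halves_le_measure_quadratic` — `x² + cx + 1`;
* `smythTheta_le_measure_of_card_support_le_three`, `not_subLehmer_of_card_support_le_three`.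
-/

namespace Summit.Ventures.DiscreteObjects.Mahler

open Polynomial

/-- Multiplying by `x^j` shifts the support: same number of monomials. -/
theorem card_support_X_pow_mul (P : ℤ[X]) (j : ℕ) : (X ^ j * P).support.card = P.support.card := by
  have h : (X ^ j * P).support = P.support.map ⟨fun a => a + j, add_left_injective j⟩ := by
    ext d
    simp only [mem_support_iff, coeff_X_pow_mul', Finset.mem_map, Function.Embedding.coeFn_mk]
    constructor
    · intro hd
      by_cases hjd : j ≤ d
      · rw [if_pos hjd] at hd
        exact ⟨d - j, hd, by omega⟩
      · rw [if_neg hjd] at hd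
        exact absurd rfl hd
    · rintro ⟨a, ha, rfl⟩
      rw [if_pos (by omega), Nat.add_sub_cancel]
      exact ha
  rw [h, Finset.card_map]

/-- `M(x^j) = 1`. -/
theorem intMahlerMeasure_X_pow (j : ℕ) : intMahlerMeasure ((X : ℤ[X]) ^ j) = 1 := by
  induction j with
  | zero => rw [pow_zero, ← C_1, intMahlerMeasure_C]; simp
  | succ j ih => rw [pow_succ, intMahlerMeasure_mul, ih, intMahlerMeasure_X, one_mul]

/-- `M(x^N + e) = 1` for `e = ±1`, `N > 0` (it divides `x^{2N} - 1`). -/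
theorem intMahlerMeasure_X_pow_add_sign {e : ℤ} (he : e = 1 ∨ e = -1) {N : ℕ} (hN : 0 < N) :
    intMahlerMeasure (X ^ N + C e : ℤ[X]) = 1 := by
  have hee : e * e = 1 := by rcases he with h | h <;> simp [h]
  have hCe : (C e : ℤ[X]) * C e = 1 := by rw [← map_mul, hee, map_one]
  refine intMahlerMeasure_eq_one_of_mul_eq_X_pow_sub_one (s := X ^ N - C e) (by omega : 0 < 2 * N) ?_
  rw [pow_mul', sq]
  linear_combination (-1 : ℤ[X]) * hCe

/-- `M(x² + cx + 1) = 1` for `|c| ≤ 2` (`Φ₄`, `Φ₃`, `Φ₆`, `(x ± 1)²`). -/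
theorem measure_quadratic_eq_one_of_abs_le_two {c : ℤ} (hc : |c| ≤ 2) :
    intMahlerMeasure (X ^ 2 + C c * X + C 1 : ℤ[X]) = 1 := by
  have hM1 : intMahlerMeasure (X + 1 : ℤ[X]) = 1 :=
    intMahlerMeasure_eq_one_of_mul_eq_X_pow_sub_one (s := X - 1) (N := 2) (by norm_num) (by ring)
  have hM2 : intMahlerMeasure (X - 1 : ℤ[X]) = 1 :=
    intMahlerMeasure_eq_one_of_mul_eq_X_pow_sub_one (s := X + 1) (N := 2) (by norm_num) (by ring)
  have hcases : c = -2 ∨ c = -1 ∨ c = 0 ∨ c = 1 ∨ c = 2 := by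
    obtain ⟨h1, h2⟩ := abs_le.mp hc; omega
  rcases hcases with h | h | h | h | h <;> rw [h]
  · have e : (X ^ 2 + C (-2 : ℤ) * X + C 1 : ℤ[X]) = (X - 1) * (X - 1) := by
      simp only [map_neg, map_ofNat, map_one]; ring
    rw [e, intMahlerMeasure_mul, hM2, one_mul]
  · exact intMahlerMeasure_eq_one_of_mul_eq_X_pow_sub_one (s := (X + 1) * (X ^ 3 - 1)) (N := 6)
      (by norm_num) (by simp only [map_neg, map_one]; ring)
  · exact intMahlerMeasure_eq_one_of_mul_eq_X_pow_sub_one (s := X ^ 2 - 1) (N := 4) (by norm_num)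
      (by simp only [map_zero, map_one]; ring)
  · exact intMahlerMeasure_eq_one_of_mul_eq_X_pow_sub_one (s := X - 1) (N := 3) (by norm_num)
      (by simp only [map_one]; ring)
  · have e : (X ^ 2 + C (2 : ℤ) * X + C 1 : ℤ[X]) = (X + 1) * (X + 1) := by
      simp only [map_ofNat, map_one]; ring
    rw [e, intMahlerMeasure_mul, hM1, one_mul]

/-- `M(x² + cx + 1) ≥ 3/2` for `|c| ≥ 3`: the real root `-(c + sign(c)√(c² - 4))/2` has modulus
`(|c| + √(c² - 4))/2 ≥ 3/2`. -/
theorem three_halves_le_measure_quadratic {c : ℤ} (hc : 3 ≤ |c|) :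
    (3 : ℝ) / 2 ≤ intMahlerMeasure (X ^ 2 + C c * X + C 1 : ℤ[X]) := by
  have hmon : (X ^ 2 + C c * X + C 1 : ℤ[X]).Monic := by
    have e : (X ^ 2 + C c * X + C 1 : ℤ[X]) = X ^ 2 + (C c * X + C 1) := by ring
    rw [e]
    refine (monic_X_pow 2).add_of_left (lt_of_le_of_lt (degree_add_le _ _) (max_lt ?_ ?_))
    · exact lt_of_le_of_lt (degree_C_mul_X_le _) (by rw [degree_X_pow]; exact_mod_cast (by norm_num : 1 < 2))
    · exact lt_of_le_of_lt degree_C_le (by rw [degree_X_pow]; exact_mod_cast (by norm_num : 0 < 2))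
  set d : ℝ := Real.sqrt ((c : ℝ) ^ 2 - 4) with hd
  have hc' : (3 : ℝ) ≤ |(c : ℝ)| := by exact_mod_cast hc
  have hdisc : (0 : ℝ) ≤ (c : ℝ) ^ 2 - 4 := by nlinarith [abs_nonneg (c : ℝ), sq_abs (c : ℝ)]
  have hd2 : d ^ 2 = (c : ℝ) ^ 2 - 4 := by rw [hd, Real.sq_sqrt hdisc]
  have hd0 : 0 ≤ d := Real.sqrt_nonneg _
  -- the root `r = -(c + σ d)/2` with `σ = sign c`, of modulus `(|c| + d)/2`
  obtain ⟨σ, hσ, hσc⟩ : ∃ σ : ℝ, (σ = 1 ∨ σ = -1) ∧ σ * (c : ℝ) = |(c : ℝ)| := by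
    rcases le_or_gt 0 (c : ℝ) with h | h
    · exact ⟨1, Or.inl rfl, by rw [one_mul, abs_of_nonneg h]⟩
    · exact ⟨-1, Or.inr rfl, by rw [abs_of_neg h]; ring⟩
  have hσσ : σ * σ = 1 := by rcases hσ with h | h <;> simp [h]
  set r : ℝ := -((c : ℝ) + σ * d) / 2 with hr
  have hroot : aeval (r : ℂ) (X ^ 2 + C c * X + C 1 : ℤ[X]) = 0 := by
    have h1 : r ^ 2 + (c : ℝ) * r + 1 = 0 := by
      rw [hr]; nlinarith [hd2, hσσ]
    simp only [map_add, map_mul, map_pow, aeval_X, eq_intCast, map_intCast, map_one]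
    have : ((r : ℂ)) ^ 2 + (c : ℂ) * (r : ℂ) + 1 = ((r ^ 2 + (c : ℝ) * r + 1 : ℝ) : ℂ) := by push_cast; ring
    rw [this, h1]; simp
  have hbound := norm_root_le_intMahlerMeasure hmon hroot
  rw [Complex.norm_real, Real.norm_eq_abs] at hbound
  have habs : |r| = (|(c : ℝ)| + d) / 2 := by
    have : r = -(σ * (|(c : ℝ)| + d)) / 2 := by
      rw [hr, ← hσc]; linear_combination ((c : ℝ) / 2) * hσσ
    rw [this, abs_div, abs_neg, abs_mul]
    have hσ1 : |σ| = 1 := by rcases hσ with h | h <;> simp [h]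
    rw [hσ1, one_mul, abs_of_nonneg (by positivity), abs_of_pos (by norm_num : (0:ℝ) < 2)]
  rw [habs] at hbound
  linarith

/-- **At most three monomials: `M(P) > 1 ⇒ M(P) ≥ θ₀`** (Smyth's constant), for every `P ∈ ℤ[X]`. -/
theorem smythTheta_le_measure_of_card_support_le_three (P : ℤ[X]) (hcard : P.support.card ≤ 3)
    (hM : 1 < intMahlerMeasure P) : smythTheta ≤ intMahlerMeasure P := by
  have hθ : smythTheta < 13248 / 10000 := smythTheta_lt
  have hP0 : P ≠ 0 := by
    intro h; rw [h] at hM; unfold intMahlerMeasure at hM; simp at hM; linarith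
  -- strip the power of `x`
  obtain ⟨P₀, hP₀, hndvd⟩ := exists_eq_pow_rootMultiplicity_mul_and_not_dvd P hP0 0
  rw [map_zero, sub_zero] at hP₀ hndvd
  set j := P.rootMultiplicity 0 with hj
  have hc0 : P₀.coeff 0 ≠ 0 := fun h => hndvd (X_dvd_iff.mpr h)
  have hMeq : intMahlerMeasure P = intMahlerMeasure P₀ := by
    rw [hP₀, intMahlerMeasure_mul, intMahlerMeasure_X_pow, one_mul]
  have hcard₀ : P₀.support.card ≤ 3 := by rw [← card_support_X_pow_mul P₀ j, ← hP₀]; exact hcard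
  rw [hMeq] at hM ⊢
  have hP₀0 : P₀ ≠ 0 := fun h => hc0 (by rw [h, coeff_zero])
  -- constants: `M = |c| ≥ 2`
  rcases Nat.eq_zero_or_pos P₀.natDegree with hd0 | hdpos
  · rw [eq_C_of_natDegree_eq_zero hd0, intMahlerMeasure_C] at hM ⊢
    have : (2 : ℝ) ≤ |(P₀.coeff 0 : ℝ)| := by
      have h1' : (1 : ℤ) < |P₀.coeff 0| := by exact_mod_cast hM
      have : (2 : ℤ) ≤ |P₀.coeff 0| := h1'
      exact_mod_cast this
    linarith
  -- nonreciprocal: Smyth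
  by_cases hrev : P₀.reverse = P₀ ∨ P₀.reverse = -P₀
  swap
  · obtain ⟨h1, h2⟩ := not_or.mp hrev
    exact intMahlerMeasure_ge_smythTheta_of_nonreciprocal hc0 h1 h2
  -- leading coefficient `≥ 2`
  by_cases hlc : 2 ≤ |P₀.leadingCoeff|
  · have h := abs_leadingCoeff_le_intMahlerMeasure P₀
    have : (2 : ℝ) ≤ |(P₀.leadingCoeff : ℝ)| := by exact_mod_cast hlc
    linarith
  -- reduce to monic `Q = ± P₀` with `Q_{n-i} = ε Q_i`
  obtain ⟨ε, hε, hrel⟩ : ∃ ε : ℤ, (ε = 1 ∨ ε = -1) ∧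
      ∀ i ≤ P₀.natDegree, P₀.coeff (P₀.natDegree - i) = ε * P₀.coeff i := by
    rcases hrev with h | h
    · refine ⟨1, Or.inl rfl, fun i hi => ?_⟩
      have hc := congrArg (fun Q : ℤ[X] => Q.coeff i) h
      simp only [coeff_reverse, revAt_le hi] at hc
      rw [hc, one_mul]
    · refine ⟨-1, Or.inr rfl, fun i hi => ?_⟩
      have hc := congrArg (fun Q : ℤ[X] => Q.coeff i) h
      simp only [coeff_reverse, revAt_le hi, coeff_neg] at hc
      rw [hc]; ring
  have hlc1 : P₀.leadingCoeff = 1 ∨ P₀.leadingCoeff = -1 := by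
    have hne : P₀.leadingCoeff ≠ 0 := leadingCoeff_ne_zero.mpr hP₀0
    have hnn := abs_nonneg P₀.leadingCoeff
    rcases abs_choice P₀.leadingCoeff with h | h <;> rw [h] at hlc hnn <;> omega
  obtain ⟨Q, hQm, hQM, hQrel, hQcard, hQdeg⟩ : ∃ Q : ℤ[X], Q.Monic ∧ intMahlerMeasure Q = intMahlerMeasure P₀ ∧
      (∀ i ≤ Q.natDegree, Q.coeff (Q.natDegree - i) = ε * Q.coeff i) ∧ Q.support.card ≤ 3 ∧
      0 < Q.natDegree := by
    rcases hlc1 with h1 | h1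
    · exact ⟨P₀, h1, rfl, hrel, hcard₀, hdpos⟩
    · refine ⟨-P₀, by rw [Monic, leadingCoeff_neg, h1, neg_neg], intMahlerMeasure_neg P₀, ?_,
        by rwa [support_neg], by rwa [natDegree_neg]⟩
      intro i hi
      rw [natDegree_neg] at hi ⊢
      rw [coeff_neg, coeff_neg, hrel i hi]; ring
  rw [← hQM] at hM ⊢
  -- support of `Q`: `{0, n}` plus at most one middle index
  set n := Q.natDegree with hn
  have hεε : ε * ε = 1 := by rcases hε with h | h <;> simp [h]
  have hε0 : ε ≠ 0 := by rcases hε with h | h <;> simp [h]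
  have hcn : Q.coeff n = 1 := hQm.coeff_natDegree
  have hq0 : Q.coeff 0 = ε := by
    have h := hQrel 0 (Nat.zero_le _)
    rw [Nat.sub_zero, hcn] at h
    linear_combination (-ε) * h + (-(Q.coeff 0)) * hεε
  set S := (Q.support.erase n).erase 0 with hS
  have hmemS : ∀ k, k ∈ S ↔ k ≠ 0 ∧ k ≠ n ∧ Q.coeff k ≠ 0 := by
    intro k; simp only [hS, Finset.mem_erase, mem_support_iff]
  have hScard : S.card ≤ 1 := by
    have h1 : n ∈ Q.support := mem_support_iff.mpr (by rw [hcn]; exact one_ne_zero)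
    have h2 : 0 ∈ Q.support.erase n := Finset.mem_erase.mpr ⟨by omega, mem_support_iff.mpr (by rw [hq0]; exact hε0)⟩
    have e1 : S.card = (Q.support.erase n).card - 1 := Finset.card_erase_of_mem h2
    have e2 : (Q.support.erase n).card = Q.support.card - 1 := Finset.card_erase_of_mem h1
    omega
  have hzero : ∀ k, k ∉ S → k ≠ 0 → k ≠ n → Q.coeff k = 0 := by
    intro k hk hk0 hkn
    by_contra h
    exact hk ((hmemS k).mpr ⟨hk0, hkn, h⟩)
  rcases Nat.eq_zero_or_pos S.card with h0 | h1
  · -- `Q = xⁿ + ε`: measure `1`, contradiction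
    have hSe : S = ∅ := Finset.card_eq_zero.mp h0
    have hQ : Q = X ^ n + C ε := by
      ext k
      simp only [coeff_add, coeff_X_pow, coeff_C]
      by_cases hk0 : k = 0
      · subst hk0; rw [if_neg (by omega), if_pos rfl, hq0, zero_add]
      by_cases hkn : k = n
      · subst hkn; rw [if_pos rfl, if_neg hk0, hcn, add_zero]
      rw [if_neg hkn, if_neg hk0, add_zero]
      exact hzero k (by rw [hSe]; exact Finset.notMem_empty k) hk0 hkn
    rw [hQ, intMahlerMeasure_X_pow_add_sign hε hQdeg] at hM
    exact absurd hM (lt_irrefl _)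
  · -- `Q = R(x^m)`, `R = x² + cx + 1`
    obtain ⟨m, hSm⟩ := Finset.card_eq_one.mp (le_antisymm hScard h1)
    have hmS : m ∈ S := by rw [hSm]; exact Finset.mem_singleton_self m
    obtain ⟨hm0, hmn, hmc⟩ := (hmemS m).mp hmS
    have hmle : m ≤ n := le_natDegree_of_ne_zero hmc
    have hnm : n - m = m := by
      have h := hQrel m hmle
      by_contra hne
      have hmem : n - m ∈ S := by
        refine (hmemS _).mpr ⟨by omega, by omega, ?_⟩
        rw [h]; exact mul_ne_zero hε0 hmc
      rw [hSm, Finset.mem_singleton] at hmem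
      exact hne hmem
    have hn2 : n = 2 * m := by omega
    have hmpos : 0 < m := Nat.pos_of_ne_zero hm0
    have hε1 : ε = 1 := by
      rcases hε with h | h
      · exact h
      · exfalso
        have h2 := hQrel m hmle
        rw [hnm, h] at h2
        have : Q.coeff m = 0 := by linarith
        exact hmc this
    set c := Q.coeff m with hc
    have hQ : Q = (X ^ 2 + C c * X + C 1 : ℤ[X]).comp (X ^ m) := by
      have e : (X ^ 2 + C c * X + C 1 : ℤ[X]).comp (X ^ m) = X ^ (2 * m) + C c * X ^ m + C 1 := by
        simp only [add_comp, mul_comp, pow_comp, X_comp, C_comp]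
        rw [← pow_mul, mul_comm]
      rw [e]
      ext k
      simp only [coeff_add, coeff_X_pow, coeff_C_mul, coeff_C]
      by_cases hk0 : k = 0
      · subst hk0
        rw [if_neg (by omega), if_neg (by omega), if_pos rfl, hq0, hε1]; ring
      by_cases hkn : k = 2 * m
      · subst hkn
        rw [if_pos rfl, if_neg (by omega), if_neg (by omega), ← hn2, hcn]; ring
      by_cases hkm : k = m
      · subst hkm
        rw [if_neg hkn, if_pos rfl, if_neg hk0]; ring
      rw [if_neg hkn, if_neg hkm, if_neg hk0]
      have : k ∉ S := by rw [hSm, Finset.mem_singleton]; exact hkm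
      rw [hzero k this hk0 (by omega)]; ring
    rw [hQ, intMahlerMeasure_comp_X_pow _ hmpos] at hM ⊢
    by_cases hc2 : |c| ≤ 2
    · rw [measure_quadratic_eq_one_of_abs_le_two hc2] at hM
      exact absurd hM (lt_irrefl _)
    · have h3 := three_halves_le_measure_quadratic (c := c) (by omega)
      linarith

/-- **No integer polynomial with at most three monomials is sub-Lehmer.** -/
theorem not_subLehmer_of_card_support_le_three (P : ℤ[X]) (hcard : P.support.card ≤ 3) :
    ¬ SubLehmer P := by
  intro h
  have hL := lehmer_measure_upper_bound
  have h1 := smythTheta_le_measure_of_card_support_le_three P hcard h.1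
  linarith [smythTheta_gt, h.2]

end Summit.Ventures.DiscreteObjects.Mahler
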